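import Summits.BirchSwinnertonDyer.BirchSwinnertonDyer.Theorems.TwinTransportX9RungSchema
import Summits.BirchSwinnertonDyer.BirchSwinnertonDyer.Theorems.TwinTransportX9WitnessRegime

/-!
# Route `TwinTransportX9` — the TWO-STEP (second-disjunct) RUNG SCHEMA of the deciding crux `TrivialTwinSupplyX9` (item 24080)

The crux body at `(W, p)` is a disjunction: the admissible twin `W₁ ≅ W^{(d_K)}` is ITSELF a certified trivial twin
(first disjunct: `r_an(W₁) = 0`, `p ∤ #Ш(W₁)·∏c_ℓ(W₁)·#W₁(ℚ)_tors`, `L(W₁,1)/Ω(W₁)` a `p`-unit), OR `W₁` admits a further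
admissible frame `(d_K', d_F')` whose twin `W₂ ≅ W₁^{(d_K')}` is one (second disjunct). Every decided instance so far
(rungs #1–#19, the 300 slice rungs, schema `rung_of_frame`) is a RANK-ONE pair landing in the FIRST disjunct. For an
X9 pair of EVEN analytic rank (e.g. `r_an(W) = 0`: the census's only instance below `10⁴` is `2268b1` at `p = 5`) the
first disjunct is unreachable by parity — a Heegner field `K = ℚ(√d_K)` for `N(W)` flips the root number,
`w(W^{(d_K)}) = -w(W)` — and the crux can only hold through the SECOND disjunct: `W ↦ W₁ = W^{(d_K)}` (odd rank) `↦
W₂ = W₁^{(d_K')}` (even rank, certified). This file proves the corresponding CLASS-WIDE REDUCTION, uniformly in all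
data: **the crux body at `(W, p)` follows from (S0) an admissible frame `(d_K, d_F)` for `W` with minimal twin
`C₀ • V₁ = W^{(d_K)}`; (S1') an admissible frame `(d_K', d_F')` for `V₁` with minimal twin `C₁ • V₂ = V₁^{(d_K')}` of
analytic rank `0` and `p`-unit `L(V₂,1)/Ω(V₂) = q`; (S2') a Heegner point `y ∈ V₁(K')`, `K'` imaginary quadratic of
discriminant `d_K'` (Heegner for a level `N₁`), of infinite order with `p ∤ [V₁(K') : ℤ y]`, together with the two
PUBLISHED named facts `kolyvagin N₁ V₁ K'` (Kolyvagin 1990 Thm. A) and Matar–Nekovář 2019 Thm. 0.3 for `(N₁, V₁, K')`.**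
The proof is `rung_of_frame`'s, run along `W → V₁ → V₂`: `ClassX9` and `ord_p ∏ c_ℓ` travel from `W` to `V₁` along the
first frame (twist stability `X9.classX9_of_smul_eq_quadraticTwist`; Jetchev–Skinner–Wan (eq:tamK) via
`Castella2018.TamagawaQuadratic.padicValNat_tamagawaProduct_quadraticTwist_eq`, its bad-prime clause vacuous by (Heeg)),
which needs only SOME quadratic field `K₀` of discriminant `d_K` (no Heegner point there); then the first-disjunct
certificate of `V₂` over `V₁` (`twinCertificate_of_frame`, = the body of `rung_of_frame` concluded as a conjunction).

HONEST FRAMING: BSD is NOT proved and NOTHING is claimed about `TrivialTwinSupplyX9` in general (named open in print,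
Prasanna 2010 p. 400); this is a REDUCTION (an implication uniform in `(W, p, d_K, d_F, K₀, V₁, C₀, d_K', d_F', K', N₁,
y, V₂, C₁, q)`), the second-disjunct companion of `rung_of_frame`. It also imports the T3 witness-regime module
(`TwinTransportX9WitnessRegime`: `sCase_11808a1_5`, `rung_11808a1_5_decides`) so that one early-sorting schema module
makes those declarations visible wherever the schema is.

References: Matar–Nekovář 2019 Thm. 0.3 [MatarNekovar2019]; Kolyvagin 1990 Thm. A [KolyvaginEulerSystems1990];
Gross 1991 §1–§2 [GrossLMS1991]; Jetchev–Skinner–Wan 2017 §7.3.1 (eq:tamK) [JetchevSkinnerWan2017];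
Burungale–Castella–Skinner 2025 §1.2, Prop. 5.2.1 [BurungaleCastellaSkinner2025]; Prasanna 2010 p. 400 [Prasanna2010CJM];
Gross–Zagier 1986 / Gross 1991 (root number of the Heegner twist) [GrossLMS1991].
-/

set_option linter.dupNamespace false
set_option autoImplicit false

noncomputable section

open scoped Classical NumberField

open WeierstrassCurve Literature.NumberTheory.EllipticCurves
  Literature.NumberTheory.EllipticCurves.Rank1Residual.X11RankOneCertificates
  Summit.BirchSwinnertonDyer.Rank1Residual.X11b
  Summit.BirchSwinnertonDyer.BirchSwinnertonDyer.Rank1Residual.IntModel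
  Summit.BirchSwinnertonDyer.BirchSwinnertonDyer.Rank1Residual
  Summit.BirchSwinnertonDyer.BirchSwinnertonDyer.Theses.TwinTransportX9

namespace Summit.BirchSwinnertonDyer.BirchSwinnertonDyer.Theorems.TwinTransportX9Rung

/-! ## §1 One admissible step: `ClassX9` and `ord_p ∏ c_ℓ` travel to the minimal twin -/

/-- **One admissible step transports the X9 hypotheses.** If `(d_K, d_F)` is BCS-admissible for `(W, p)`, `K₀` is a
quadratic field of discriminant `d_K`, and `C • V = W^{(d_K)}` with `V` globally minimal, then `ClassX9 W p` and
`p ∤ ∏ c_ℓ(W)` give `ClassX9 V p` and `p ∤ ∏ c_ℓ(V)`: `ClassX9` is twist-stable (`p ∤ d_K` is admissibility (spl),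
`d_K` square-free is (disc)), and `ord_p ∏ c_ℓ(V) = ord_p ∏ c_ℓ(W)` by Jetchev–Skinner–Wan (eq:tamK), whose bad-prime
clause is vacuous because every `ℓ ∣ N(W)` splits in `K₀` by (Heeg). No Heegner point is involved.
[cite: JetchevSkinnerWan2017, §7.3.1 (eq:tamK)] [cite: BurungaleCastellaSkinner2025, §1.2 (disc)/(Heeg)/(spl)] -/
theorem classX9_and_not_dvd_tamagawaProduct_of_frame (W : WeierstrassCurve ℚ) [W.IsElliptic] [W.IsGloballyMinimal]
    {p : ℕ} [Fact p.Prime] {dK dF : ℤ} (hadm : BCSAdmissiblePair W p dK dF)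
    {K₀ : Type} [Field K₀] [NumberField K₀] (hK₀ : Module.finrank ℚ K₀ = 2) (hdK₀ : NumberField.discr K₀ = dK)
    (V : WeierstrassCurve ℚ) [V.IsElliptic] [V.IsGloballyMinimal] {C : VariableChange ℚ}
    (hC : C • V = W.quadraticTwist (dK : ℚ)) (hX9 : ClassX9 W p) (hTam : ¬ p ∣ W.tamagawaProduct) :
    ClassX9 V p ∧ ¬ p ∣ V.tamagawaProduct := by
  have hp : p.Prime := Fact.out
  have hp5 : 5 ≤ p := hX9.2.1
  have hsqf : Squarefree dK := hadm.1.2.1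
  have hpd : ¬ (p : ℤ) ∣ dK := hadm.2.2.1.1
  have hX9V : ClassX9 V p :=
    Summit.BirchSwinnertonDyer.Rank1Residual.X9.classX9_of_smul_eq_quadraticTwist W V p hX9 hsqf hC hpd
  have htamv : padicValNat p V.tamagawaProduct = padicValNat p W.tamagawaProduct :=
    Castella2018.TamagawaQuadratic.padicValNat_tamagawaProduct_quadraticTwist_eq W p K₀ V hp5 hK₀
      (fun ℓ _ hℓN hns => absurd (ncard_primesOver_eq_two_of_bcsAdmissiblePair W hadm hK₀ hdK₀ Fact.out hℓN) hns)
      ⟨C⁻¹, by rw [hdK₀, ← hC, inv_smul_smul]⟩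
  exact ⟨hX9V, not_dvd_of_padicValNat_eq_zero hp V.tamagawaProduct_pos' (htamv.trans (padicValNat.eq_zero_of_not_dvd hTam))⟩

/-! ## §2 The first-disjunct certificate of a twin, as a conjunction -/

/-- **The twin certificate of one frame** (the body of `rung_of_frame`, concluded as the conjunction the crux asks of a
trivial twin). For `(d_K, d_F)` admissible at `(E, p)`, `K` imaginary quadratic of discriminant `d_K` with the Heegner
hypothesis for a level `N`, the named facts `kolyvagin N E K` and Matar–Nekovář Thm. 0.3 for `(N, E, K)`, a Heegner point
`y ∈ E(K)` of infinite order with `p ∤ [E(K) : ℤ y]`, and a globally minimal `V` with `C • V = E^{(d_K)}`, `r_an(V) = 0`,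
`L(V,1)/Ω(V) = q`, `ord_p q = 0`: if `ClassX9 E p` and `p ∤ ∏ c_ℓ(E)` then
`r_an(V) = 0 ∧ p ∤ #Ш(V) ∧ p ∤ ∏ c_ℓ(V) ∧ p ∤ #V(ℚ)_tors ∧ ∃ q, L(V,1)/Ω(V) = q ∧ ord_p q = 0`.
[cite: MatarNekovar2019, Thm. 0.3 (p. 456)] [cite: KolyvaginEulerSystems1990, Thm. A]
[cite: GrossLMS1991, §2 Prop. 2.1 (2), Prop. 2.3] [cite: JetchevSkinnerWan2017, §7.3.1 (eq:tamK)]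
[cite: BurungaleCastellaSkinner2025, §1.2, Prop. 5.2.1] -/
theorem twinCertificate_of_frame (E : WeierstrassCurve ℚ) [E.IsElliptic] [E.IsGloballyMinimal] {p : ℕ} [Fact p.Prime]
    {dK dF : ℤ} (hadm : BCSAdmissiblePair E p dK dF)
    {K : Type} [Field K] [NumberField K] (hK : IsImaginaryQuadratic K) (hdK : NumberField.discr K = dK)
    {N : ℕ} [NeZero N] (hH : SatisfiesHeegnerHypothesis N K) (hKo : kolyvagin N E K)
    (hMN : MatarNekovar2019.thm03_padicValNat_card_sha_le_of_irreducible N E K)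
    {P : (E.baseChange K).toAffine.Point} (hP : IsHeegnerPoint N E K P) (hnt : ¬ IsOfFinAddOrder P)
    (hI : ¬ p ∣ (AddSubgroup.zmultiples P).index)
    (V : WeierstrassCurve ℚ) [V.IsElliptic] [V.IsGloballyMinimal] {C : VariableChange ℚ}
    (hC : C • V = E.quadraticTwist (dK : ℚ)) (hr : V.analyticRank = 0) {q₀ : ℚ}
    (hL : V.leadingLCoeff / (V.realPeriodRat : ℂ) = (q₀ : ℂ)) (hq : padicValRat p q₀ = 0)
    (hX9 : ClassX9 E p) (hTam : ¬ p ∣ E.tamagawaProduct) :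
    V.analyticRank = 0 ∧ ¬ p ∣ V.shaOrder ∧ ¬ p ∣ V.tamagawaProduct ∧ ¬ p ∣ V.torsionOrder ∧
      ∃ q : ℚ, V.leadingLCoeff / (V.realPeriodRat : ℂ) = (q : ℂ) ∧ padicValRat p q = 0 := by
  have hp : p.Prime := Fact.out
  have hp5 : 5 ≤ p := hX9.2.1
  have hp2 : p ≠ 2 := by omega
  have hirr : E.HasIrreducibleModPGaloisRep p := hX9.2.2.2.2.1
  have hdneg : dK < 0 := hadm.1.1
  have hd3 : dK ≠ -3 := hadm.1.2.2.2
  have hd4 : dK ≠ -4 := by have := hadm.1.2.2.1; omega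
  have hdQ : (dK : ℚ) ≠ 0 := by exact_mod_cast hdneg.ne
  haveI iT : (E.quadraticTwist (dK : ℚ)).IsElliptic := isElliptic_quadraticTwist _ hdQ
  -- `Ш`: Kolyvagin + Matar–Nekovář over `K`, transported to the twist model, then to the minimal twin `V`
  have hshaT : ¬ p ∣ (E.quadraticTwist (dK : ℚ)).shaOrder :=
    (shaFinite_and_not_dvd_shaOrder_twist_of_mn03 E hK hdK hdneg hd3 hd4 hH hKo hMN hP hnt hp2 hirr hI
      (E.quadraticTwist (dK : ℚ)) rfl).2
  have hsv : (C • V).shaOrder = V.shaOrder := shaOrder_variableChange_holds _ _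
  have hsha : ¬ p ∣ V.shaOrder := by rw [← hsv, hC]; exact hshaT
  -- `ClassX9` and Tamagawa along the frame; torsion from irreducibility of `ρ̄_{V,p}`
  obtain ⟨hX9V, htam⟩ := classX9_and_not_dvd_tamagawaProduct_of_frame E hadm hK.1 hdK V hC hX9 hTam
  have htors : ¬ p ∣ V.torsionOrder :=
    not_dvd_of_padicValNat_eq_zero hp V.torsionOrder_pos_holds
      (Rank1Residual.padicValNat_torsionOrder_eq_zero_of_irreducible V p hX9V.2.2.2.2.1)
  exact ⟨hr, hsha, htam, htors, q₀, hL, hq⟩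

/-! ## §3 The two-step rung schema (second disjunct) -/

/-- **THE TWO-STEP RUNG SCHEMA (class-wide reduction, second disjunct).** For ANY globally minimal elliptic `W/ℚ` and
prime `p`; a BCS-admissible frame `(d_K, d_F)` at `(W, p)`, SOME quadratic field `K₀` of discriminant `d_K`, and a
globally minimal `V₁` with `C₀ • V₁ = W^{(d_K)}` (S0); a BCS-admissible frame `(d_K', d_F')` at `(V₁, p)`, an imaginary
quadratic `K'` of discriminant `d_K'` with the Heegner hypothesis for a level `N₁`, the named facts `kolyvagin N₁ V₁ K'`
(Kolyvagin 1990 Thm. A) and Matar–Nekovář 2019 Thm. 0.3 for `(N₁, V₁, K')`, a Heegner point `y ∈ V₁(K')` of infinite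
order with `p ∤ [V₁(K') : ℤ y]` (S2'); and a globally minimal `V₂` with `C₁ • V₂ = V₁^{(d_K')}`, `r_an(V₂) = 0`,
`L(V₂,1)/Ω(V₂) = q`, `ord_p q = 0` (S1'): the crux body of `TrivialTwinSupplyX9` holds at `(W, p)` — SECOND disjunct,
witnessed by `(d_K, d_F)`, `V₁`, `(d_K', d_F')`, `V₂`. This is the shape forced on every X9 pair of EVEN analytic
rank (`w(W^{(d_K)}) = -w(W)` for a Heegner field). HONEST FRAMING: a REDUCTION uniform in all displayed data; it
proves neither the crux (the supply of the two frames for every X9 pair is open: Prasanna 2010 p. 400) nor BSD.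
[cite: MatarNekovar2019, Thm. 0.3 (p. 456)] [cite: KolyvaginEulerSystems1990, Thm. A]
[cite: GrossLMS1991, §2 Prop. 2.1 (2), Prop. 2.3] [cite: JetchevSkinnerWan2017, §7.3.1 (eq:tamK)]
[cite: BurungaleCastellaSkinner2025, §1.2, Prop. 5.2.1] [cite: Prasanna2010CJM, p. 400 (Introduction)] -/
theorem rung_of_two_frames (W : WeierstrassCurve ℚ) [W.IsElliptic] [W.IsGloballyMinimal] {p : ℕ} [Fact p.Prime]
    {dK₀ dF₀ : ℤ} (hadm₀ : BCSAdmissiblePair W p dK₀ dF₀)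
    {K₀ : Type} [Field K₀] [NumberField K₀] (hK₀ : Module.finrank ℚ K₀ = 2) (hdK₀ : NumberField.discr K₀ = dK₀)
    (V₁ : WeierstrassCurve ℚ) [V₁.IsElliptic] [V₁.IsGloballyMinimal] {C₀ : VariableChange ℚ}
    (hC₀ : C₀ • V₁ = W.quadraticTwist (dK₀ : ℚ))
    {dK₁ dF₁ : ℤ} (hadm₁ : BCSAdmissiblePair V₁ p dK₁ dF₁)
    {K₁ : Type} [Field K₁] [NumberField K₁] (hK₁ : IsImaginaryQuadratic K₁) (hdK₁ : NumberField.discr K₁ = dK₁)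
    {N₁ : ℕ} [NeZero N₁] (hH : SatisfiesHeegnerHypothesis N₁ K₁) (hKo : kolyvagin N₁ V₁ K₁)
    (hMN : MatarNekovar2019.thm03_padicValNat_card_sha_le_of_irreducible N₁ V₁ K₁)
    {P : (V₁.baseChange K₁).toAffine.Point} (hP : IsHeegnerPoint N₁ V₁ K₁ P) (hnt : ¬ IsOfFinAddOrder P)
    (hI : ¬ p ∣ (AddSubgroup.zmultiples P).index)
    (V₂ : WeierstrassCurve ℚ) [V₂.IsElliptic] [V₂.IsGloballyMinimal] {C₁ : VariableChange ℚ}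
    (hC₁ : C₁ • V₂ = V₁.quadraticTwist (dK₁ : ℚ)) (hr₂ : V₂.analyticRank = 0) {q₀ : ℚ}
    (hL₂ : V₂.leadingLCoeff / (V₂.realPeriodRat : ℂ) = (q₀ : ℂ)) (hq : padicValRat p q₀ = 0) :
    ClassX9 W p → ¬ p ∣ W.tamagawaProduct → ∃ dK dF : ℤ, BCSAdmissiblePair W p dK dF ∧
      ∃ (W₁ : WeierstrassCurve ℚ) (_ : W₁.IsElliptic) (_ : W₁.IsGloballyMinimal),
        (∃ C : WeierstrassCurve.VariableChange ℚ, C • W₁ = W.quadraticTwist (dK : ℚ)) ∧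
        ((W₁.analyticRank = 0 ∧ ¬ p ∣ W₁.shaOrder ∧ ¬ p ∣ W₁.tamagawaProduct ∧ ¬ p ∣ W₁.torsionOrder ∧
            ∃ q : ℚ, W₁.leadingLCoeff / (W₁.realPeriodRat : ℂ) = (q : ℂ) ∧ padicValRat p q = 0) ∨
          ∃ dK' dF' : ℤ, BCSAdmissiblePair W₁ p dK' dF' ∧
            ∃ (W₂ : WeierstrassCurve ℚ) (_ : W₂.IsElliptic) (_ : W₂.IsGloballyMinimal),
              (∃ C : WeierstrassCurve.VariableChange ℚ, C • W₂ = W₁.quadraticTwist (dK' : ℚ)) ∧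
              (W₂.analyticRank = 0 ∧ ¬ p ∣ W₂.shaOrder ∧ ¬ p ∣ W₂.tamagawaProduct ∧ ¬ p ∣ W₂.torsionOrder ∧
                ∃ q : ℚ, W₂.leadingLCoeff / (W₂.realPeriodRat : ℂ) = (q : ℂ) ∧ padicValRat p q = 0)) := by
  intro hX9 hTam
  obtain ⟨hX9₁, hTam₁⟩ := classX9_and_not_dvd_tamagawaProduct_of_frame W hadm₀ hK₀ hdK₀ V₁ hC₀ hX9 hTam
  exact ⟨dK₀, dF₀, hadm₀, V₁, ‹_›, ‹_›, ⟨C₀, hC₀⟩, Or.inr ⟨dK₁, dF₁, hadm₁, V₂, ‹_›, ‹_›, ⟨C₁, hC₁⟩,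
    twinCertificate_of_frame V₁ hadm₁ hK₁ hdK₁ hH hKo hMN hP hnt hI V₂ hC₁ hr₂ hL₂ hq hX9₁ hTam₁⟩⟩

/-- **`rung_of_frame` with the twin exposed**: the one-frame schema re-derived from `twinCertificate_of_frame`, concluding
the first-disjunct data OF THE GIVEN `V₁` (not the crux's existential) — the form a two-step instance consumes for its
inner step, and the record that both schemas run one engine. A reduction; proves neither the crux nor BSD.
[cite: BurungaleCastellaSkinner2025, §1.2 and Prop. 5.2.1] [cite: MatarNekovar2019, Thm. 0.3 (p. 456)] -/
theorem rung_of_frame' (W : WeierstrassCurve ℚ) [W.IsElliptic] [W.IsGloballyMinimal] {p : ℕ} [Fact p.Prime]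
    {dK₀ dF₀ : ℤ} (hadm : BCSAdmissiblePair W p dK₀ dF₀)
    {K : Type} [Field K] [NumberField K] (hK : IsImaginaryQuadratic K) (hdK : NumberField.discr K = dK₀)
    {N : ℕ} [NeZero N] (hH : SatisfiesHeegnerHypothesis N K) (hKo : kolyvagin N W K)
    (hMN : MatarNekovar2019.thm03_padicValNat_card_sha_le_of_irreducible N W K)
    {P : (W.baseChange K).toAffine.Point} (hP : IsHeegnerPoint N W K P) (hnt : ¬ IsOfFinAddOrder P)
    (hI : ¬ p ∣ (AddSubgroup.zmultiples P).index)
    (V₁ : WeierstrassCurve ℚ) [V₁.IsElliptic] [V₁.IsGloballyMinimal] {C₀ : VariableChange ℚ}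
    (hC : C₀ • V₁ = W.quadraticTwist (dK₀ : ℚ)) (hr₁ : V₁.analyticRank = 0) {q₀ : ℚ}
    (hL₁ : V₁.leadingLCoeff / (V₁.realPeriodRat : ℂ) = (q₀ : ℂ)) (hq : padicValRat p q₀ = 0) :
    ClassX9 W p → ¬ p ∣ W.tamagawaProduct →
      ∃ (W₁ : WeierstrassCurve ℚ) (_ : W₁.IsElliptic) (_ : W₁.IsGloballyMinimal),
        (∃ C : WeierstrassCurve.VariableChange ℚ, C • W₁ = W.quadraticTwist (dK₀ : ℚ)) ∧
        (W₁.analyticRank = 0 ∧ ¬ p ∣ W₁.shaOrder ∧ ¬ p ∣ W₁.tamagawaProduct ∧ ¬ p ∣ W₁.torsionOrder ∧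
            ∃ q : ℚ, W₁.leadingLCoeff / (W₁.realPeriodRat : ℂ) = (q : ℂ) ∧ padicValRat p q = 0) :=
  fun hX9 hTam => ⟨V₁, ‹_›, ‹_›, ⟨C₀, hC⟩, twinCertificate_of_frame W hadm hK hdK hH hKo hMN hP hnt hI V₁ hC hr₁ hL₁ hq hX9 hTam⟩

end Summit.BirchSwinnertonDyer.BirchSwinnertonDyer.Theorems.TwinTransportX9Rung

end
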